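import Summits.HodgeConjecture.HodgeConjecture.Theorems.CyclicUnitaryPowersEigenPairing
import Summits.HodgeConjecture.HodgeConjecture.Theorems.CyclicUnitaryPowersDeckUnitaryGroup

/-!
# Block extension: an automorphism of one eigenblock extends to the connected deck-unitary group

Helper for stub D₂ `stub_deckUnitaryCommutatorGeneration` of the crux `PowersHodgeOfDeckCommutators`
(stmt-HodgeConjecture-19545, route `CyclicUnitaryPowers`, line `unitary-kunneth-fft` v5, lane 2), step (b1)–(b2) of
HOME/memos/STUB-PLAN-D2b-Bx.md.  For `σ ^ p = 1`, `ζ` a primitive root, `B` a symmetric nondegenerate `σ`-invariant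
form and `0 < j < p` with `j ≠ p - j`:

* `contra A` — the `B`-contragredient of `A : E_j ≃ₗ E_j` on `E_{p-j}` (`B x (contra A y) = B (A⁻¹ x) y`), via the
  landed perfect pairing `eigenPairingEquiv`;
* `extLin A = (1 - P_j - P_{p-j}) + ι_j A π_j + ι_{p-j} (contra A) π_{p-j}` and its properties: multiplicative
  (`extLin_mul`), `extLin 1 = 1`, the automorphism `ext A`, `ext_mem_centIso` (`ext A ∈ U⁰(K)`), `ext_apply_of_mem`
  (`ext A` is `A` on `E_j`), `ext_mul` (a group homomorphism);
* `centIso_eq_of_eq_on` — the uniqueness principle: two elements of `U⁰(K)` agreeing on `E_j` agree on `E_{p-j}`.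
-/

noncomputable section

open Module
open scoped BigOperators

namespace Summit.HodgeConjecture.HodgeConjecture.Theorems.CyclicUnitaryPowersBlockExtension

open Summit.HodgeConjecture.HodgeConjecture.Theorems.CyclicUnitaryPowersSpectralProjectors
open Summit.HodgeConjecture.HodgeConjecture.Theorems.CyclicUnitaryPowersEigenPairing
open Summit.HodgeConjecture.HodgeConjecture.Theorems.CyclicUnitaryPowersDeckUnitaryGroup

variable {K : Type*} [Field K] [CharZero K] {W : Type*} [AddCommGroup W] [Module K W] [FiniteDimensional K W]
variable {σ : W →ₗ[K] W} {ζ : K} {p : ℕ} {B : LinearMap.BilinForm K W}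

/-! ### §1 The contragredient on the opposite block -/

section Contra

variable (hσ : σ ^ p = 1) (hζ : IsPrimitiveRoot ζ p) (hp : 0 < p) (hB : ∀ x y, B (σ x) (σ y) = B x y)
  (hBn : B.Nondegenerate) {j : ℕ} (hj : j < p) (hj' : p - j < p) (hjj : p ∣ j + (p - j))

/-- The `B`-contragredient of `A ∈ GL(E_j)` acting on `E_{p-j}`: `Φ⁻¹ ∘ (A⁻¹)^∨ ∘ Φ` with `Φ : E_{p-j} ≃ Dual E_j`
the pairing. [folklore] -/
def contra (A : E σ ζ p j ≃ₗ[K] E σ ζ p j) : E σ ζ p (p - j) ≃ₗ[K] E σ ζ p (p - j) :=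
  ((eigenPairingEquiv hσ hζ hp hB hBn hj hj' hjj).trans A.symm.dualMap).trans
    (eigenPairingEquiv hσ hζ hp hB hBn hj hj' hjj).symm

/-- Defining property: `B x (contra A y) = B (A⁻¹ x) y`. [folklore] -/
theorem apply_contra (A : E σ ζ p j ≃ₗ[K] E σ ζ p j) (x : E σ ζ p j) (y : E σ ζ p (p - j)) :
    B (x : W) (contra hσ hζ hp hB hBn hj hj' hjj A y : W) = B (A.symm x : W) (y : W) := by
  have h := LinearEquiv.apply_symm_apply (eigenPairingEquiv hσ hζ hp hB hBn hj hj' hjj)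
    (A.symm.dualMap (eigenPairingEquiv hσ hζ hp hB hBn hj hj' hjj y))
  have h' := congrArg (fun φ : Module.Dual K (E σ ζ p j) => φ x) h
  simp only [LinearEquiv.dualMap_apply, eigenPairingEquiv_apply] at h'
  rw [← h']
  rfl

/-- `contra` is multiplicative. [folklore] -/
theorem contra_mul (A A₂ : E σ ζ p j ≃ₗ[K] E σ ζ p j) :
    contra hσ hζ hp hB hBn hj hj' hjj (A * A₂) =
      contra hσ hζ hp hB hBn hj hj' hjj A * contra hσ hζ hp hB hBn hj hj' hjj A₂ := by
  apply LinearEquiv.ext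
  intro y
  apply Subtype.ext
  apply eq_of_forall_apply_eigenblock hσ hζ hp hB hBn hj hjj (contra hσ hζ hp hB hBn hj hj' hjj _ y).2
    ((contra hσ hζ hp hB hBn hj hj' hjj A * contra hσ hζ hp hB hBn hj hj' hjj A₂) y).2
  intro x hx
  have h1 := apply_contra hσ hζ hp hB hBn hj hj' hjj (A * A₂) ⟨x, hx⟩ y
  have h2 := apply_contra hσ hζ hp hB hBn hj hj' hjj A ⟨x, hx⟩ (contra hσ hζ hp hB hBn hj hj' hjj A₂ y)
  have h3 := apply_contra hσ hζ hp hB hBn hj hj' hjj A₂ (A.symm ⟨x, hx⟩) y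
  rw [LinearEquiv.mul_apply, h1, h2, h3]
  rfl

/-- `contra 1 = 1`. [folklore] -/
theorem contra_one : contra hσ hζ hp hB hBn hj hj' hjj 1 = 1 := by
  apply LinearEquiv.ext
  intro y
  apply Subtype.ext
  apply eq_of_forall_apply_eigenblock hσ hζ hp hB hBn hj hjj (contra hσ hζ hp hB hBn hj hj' hjj _ y).2 y.2
  intro x hx
  rw [apply_contra hσ hζ hp hB hBn hj hj' hjj 1 ⟨x, hx⟩ y]
  rfl

end Contra

/-! ### §2 The extension as a linear map -/

section Ext

variable (hσ : σ ^ p = 1) (hζ : IsPrimitiveRoot ζ p) (hp : 0 < p) (hB : ∀ x y, B (σ x) (σ y) = B x y)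
  (hBn : B.Nondegenerate) {j : ℕ} (hj : j < p) (hj' : p - j < p) (hjj : p ∣ j + (p - j))

/-- `extLin A = (1 - P_j - P_{p-j}) + ι_j ∘ A ∘ π_j + ι_{p-j} ∘ contra A ∘ π_{p-j}`. [folklore] -/
def extLin (A : E σ ζ p j ≃ₗ[K] E σ ζ p j) : Module.End K W :=
  (1 - specProj σ ζ p j - specProj σ ζ p (p - j)) +
    (E σ ζ p j).subtype ∘ₗ (A : E σ ζ p j →ₗ[K] E σ ζ p j) ∘ₗ (specProj σ ζ p j).rangeRestrict +
    (E σ ζ p (p - j)).subtype ∘ₗ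
      (contra hσ hζ hp hB hBn hj hj' hjj A : E σ ζ p (p - j) →ₗ[K] E σ ζ p (p - j)) ∘ₗ
        (specProj σ ζ p (p - j)).rangeRestrict

/-- `extLin A` on a vector, expanded. [folklore] -/
theorem extLin_apply (A : E σ ζ p j ≃ₗ[K] E σ ζ p j) (w : W) :
    extLin hσ hζ hp hB hBn hj hj' hjj A w =
      (w - specProj σ ζ p j w - specProj σ ζ p (p - j) w) +
        (A ⟨specProj σ ζ p j w, ⟨w, rfl⟩⟩ : W) +
        (contra hσ hζ hp hB hBn hj hj' hjj A ⟨specProj σ ζ p (p - j) w, ⟨w, rfl⟩⟩ : W) := by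
  rfl

omit [FiniteDimensional K W] in
/-- `P_j` is the identity on `E_j` (subtype form). [folklore] -/
theorem specProj_coe (hσ₀ : σ ^ p = 1) (hζ₀ : IsPrimitiveRoot ζ p) (hp₀ : 0 < p) {k : ℕ} (x : E σ ζ p k) :
    specProj σ ζ p k (x : W) = x :=
  specProj_apply_of_mem_eigenspace hζ₀ hp₀ k ((range_specProj hσ₀ hζ₀ hp₀ k).le x.2)

omit [FiniteDimensional K W] in
/-- `P_k` kills `E_l` for `k ≠ l` (`k, l < p`). [folklore] -/
theorem specProj_coe_of_ne (hσ₀ : σ ^ p = 1) (hζ₀ : IsPrimitiveRoot ζ p) (hp₀ : 0 < p) {k l : ℕ} (hk : k < p)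
    (hl : l < p) (hkl : k ≠ l) (x : E σ ζ p l) : specProj σ ζ p k (x : W) = 0 :=
  specProj_apply_of_mem_eigenspace_of_ne hζ₀ hp₀ hk hl hkl ((range_specProj hσ₀ hζ₀ hp₀ l).le x.2)

/-- **`extLin A` acts as `A` on `E_j`.** [folklore] -/
theorem extLin_apply_of_mem (hne : j ≠ p - j) (A : E σ ζ p j ≃ₗ[K] E σ ζ p j) (x : E σ ζ p j) :
    extLin hσ hζ hp hB hBn hj hj' hjj A (x : W) = (A x : W) := by
  rw [extLin_apply]
  have h1 : specProj σ ζ p j (x : W) = x := specProj_coe hσ hζ hp x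
  have h2 : specProj σ ζ p (p - j) (x : W) = 0 := specProj_coe_of_ne hσ hζ hp hj' hj (Ne.symm hne) x
  have h3 : (⟨specProj σ ζ p j (x : W), ⟨(x : W), rfl⟩⟩ : E σ ζ p j) = x := Subtype.ext h1
  have h4 : (⟨specProj σ ζ p (p - j) (x : W), ⟨(x : W), rfl⟩⟩ : E σ ζ p (p - j)) = 0 := Subtype.ext h2
  rw [h3, h4, map_zero, Submodule.coe_zero, add_zero, h1, h2, sub_zero, sub_self, zero_add]

/-- **`extLin A` acts as `contra A` on `E_{p-j}`.** [folklore] -/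
theorem extLin_apply_of_mem' (hne : j ≠ p - j) (A : E σ ζ p j ≃ₗ[K] E σ ζ p j) (y : E σ ζ p (p - j)) :
    extLin hσ hζ hp hB hBn hj hj' hjj A (y : W) = (contra hσ hζ hp hB hBn hj hj' hjj A y : W) := by
  rw [extLin_apply]
  have h1 : specProj σ ζ p (p - j) (y : W) = y := specProj_coe hσ hζ hp y
  have h2 : specProj σ ζ p j (y : W) = 0 := specProj_coe_of_ne hσ hζ hp hj hj' hne y
  have h3 : (⟨specProj σ ζ p (p - j) (y : W), ⟨(y : W), rfl⟩⟩ : E σ ζ p (p - j)) = y := Subtype.ext h1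
  have h4 : (⟨specProj σ ζ p j (y : W), ⟨(y : W), rfl⟩⟩ : E σ ζ p j) = 0 := Subtype.ext h2
  rw [h3, h4, map_zero, Submodule.coe_zero, add_zero, h1, h2, sub_zero, sub_self, zero_add]

/-- **`extLin A` is the identity on the other blocks** `E_m`, `m ∉ {j, p-j}`, `m < p`. [folklore] -/
theorem extLin_apply_of_mem_other (A : E σ ζ p j ≃ₗ[K] E σ ζ p j) {m : ℕ} (hm : m < p) (hmj : m ≠ j)
    (hmj' : m ≠ p - j) (x : E σ ζ p m) : extLin hσ hζ hp hB hBn hj hj' hjj A (x : W) = x := by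
  rw [extLin_apply]
  have h1 : specProj σ ζ p j (x : W) = 0 := specProj_coe_of_ne hσ hζ hp hj hm (Ne.symm hmj) x
  have h2 : specProj σ ζ p (p - j) (x : W) = 0 := specProj_coe_of_ne hσ hζ hp hj' hm (Ne.symm hmj') x
  have h3 : (⟨specProj σ ζ p j (x : W), ⟨(x : W), rfl⟩⟩ : E σ ζ p j) = 0 := Subtype.ext h1
  have h4 : (⟨specProj σ ζ p (p - j) (x : W), ⟨(x : W), rfl⟩⟩ : E σ ζ p (p - j)) = 0 := Subtype.ext h2
  rw [h3, h4, map_zero, map_zero, Submodule.coe_zero, Submodule.coe_zero, add_zero, add_zero, h1, h2, sub_zero,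
    sub_zero]

omit [FiniteDimensional K W] in
/-- **Extensionality along the eigenblocks**: two linear maps out of `W` agreeing on every `E_m`, `m < p`, are equal.
[folklore] -/
theorem linearMap_ext_of_eigenblocks (hζ₀ : IsPrimitiveRoot ζ p) (hp₀ : 0 < p) {W' : Type*} [AddCommGroup W']
    [Module K W'] {f g : W →ₗ[K] W'} (h : ∀ m, m < p → ∀ x ∈ E σ ζ p m, f x = g x) : f = g := by
  apply LinearMap.ext
  intro w
  rw [← sum_specProj_apply (σ := σ) hζ₀ hp₀ w, map_sum, map_sum]
  exact Finset.sum_congr rfl fun m hm => h m (Finset.mem_range.mp hm) _ ⟨w, rfl⟩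

/-- **`extLin` is multiplicative.** [folklore] -/
theorem extLin_mul (hne : j ≠ p - j) (A A₂ : E σ ζ p j ≃ₗ[K] E σ ζ p j) :
    extLin hσ hζ hp hB hBn hj hj' hjj A * extLin hσ hζ hp hB hBn hj hj' hjj A₂ =
      extLin hσ hζ hp hB hBn hj hj' hjj (A * A₂) := by
  refine linearMap_ext_of_eigenblocks (σ := σ) hζ hp fun m hm x hx => ?_
  rw [Module.End.mul_apply]
  by_cases hmj : m = j
  · subst hmj
    rw [extLin_apply_of_mem hσ hζ hp hB hBn hj hj' hjj hne A₂ ⟨x, hx⟩,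
      extLin_apply_of_mem hσ hζ hp hB hBn hj hj' hjj hne A _,
      extLin_apply_of_mem hσ hζ hp hB hBn hj hj' hjj hne (A * A₂) ⟨x, hx⟩, LinearEquiv.mul_apply]
  · by_cases hmj' : m = p - j
    · subst hmj'
      rw [extLin_apply_of_mem' hσ hζ hp hB hBn hj hj' hjj hne A₂ ⟨x, hx⟩,
        extLin_apply_of_mem' hσ hζ hp hB hBn hj hj' hjj hne A _,
        extLin_apply_of_mem' hσ hζ hp hB hBn hj hj' hjj hne (A * A₂) ⟨x, hx⟩,
        contra_mul, LinearEquiv.mul_apply]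
    · rw [extLin_apply_of_mem_other hσ hζ hp hB hBn hj hj' hjj A₂ hm hmj hmj' ⟨x, hx⟩,
        extLin_apply_of_mem_other hσ hζ hp hB hBn hj hj' hjj A hm hmj hmj' ⟨x, hx⟩,
        extLin_apply_of_mem_other hσ hζ hp hB hBn hj hj' hjj (A * A₂) hm hmj hmj' ⟨x, hx⟩]

/-- **`extLin 1 = 1`.** [folklore] -/
theorem extLin_one (hne : j ≠ p - j) : extLin hσ hζ hp hB hBn hj hj' hjj 1 = 1 := by
  refine linearMap_ext_of_eigenblocks (σ := σ) hζ hp fun m hm x hx => ?_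
  rw [Module.End.one_apply]
  by_cases hmj : m = j
  · subst hmj
    rw [extLin_apply_of_mem hσ hζ hp hB hBn hj hj' hjj hne 1 ⟨x, hx⟩]; rfl
  · by_cases hmj' : m = p - j
    · subst hmj'
      rw [extLin_apply_of_mem' hσ hζ hp hB hBn hj hj' hjj hne 1 ⟨x, hx⟩, contra_one]; rfl
    · rw [extLin_apply_of_mem_other hσ hζ hp hB hBn hj hj' hjj 1 hm hmj hmj' ⟨x, hx⟩]

/-- **The block extension** `ext A ∈ GL(W)` (inverse `extLin A⁻¹`). [folklore] -/
def ext (hne : j ≠ p - j) (A : E σ ζ p j ≃ₗ[K] E σ ζ p j) : W ≃ₗ[K] W :=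
  LinearEquiv.ofLinear (extLin hσ hζ hp hB hBn hj hj' hjj A) (extLin hσ hζ hp hB hBn hj hj' hjj A⁻¹)
    (by rw [← Module.End.mul_eq_comp, extLin_mul hσ hζ hp hB hBn hj hj' hjj hne, mul_inv_cancel,
      extLin_one hσ hζ hp hB hBn hj hj' hjj hne]; rfl)
    (by rw [← Module.End.mul_eq_comp, extLin_mul hσ hζ hp hB hBn hj hj' hjj hne, inv_mul_cancel,
      extLin_one hσ hζ hp hB hBn hj hj' hjj hne]; rfl)

/-- The linear map underlying `ext A`. [folklore] -/
theorem coe_ext (hne : j ≠ p - j) (A : E σ ζ p j ≃ₗ[K] E σ ζ p j) :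
    ((ext hσ hζ hp hB hBn hj hj' hjj hne A : W ≃ₗ[K] W) : W →ₗ[K] W) = extLin hσ hζ hp hB hBn hj hj' hjj A := rfl

/-- `ext` is multiplicative. [folklore] -/
theorem ext_mul (hne : j ≠ p - j) (A A₂ : E σ ζ p j ≃ₗ[K] E σ ζ p j) :
    ext hσ hζ hp hB hBn hj hj' hjj hne (A * A₂) = ext hσ hζ hp hB hBn hj hj' hjj hne A * ext hσ hζ hp hB hBn hj hj' hjj hne A₂ := by
  apply LinearEquiv.toLinearMap_injective
  rw [LinearEquiv.coe_toLinearMap_mul, coe_ext, coe_ext, coe_ext, extLin_mul hσ hζ hp hB hBn hj hj' hjj hne]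

/-- `ext A` is `A` on `E_j`. [folklore] -/
theorem ext_apply_of_mem (hne : j ≠ p - j) (A : E σ ζ p j ≃ₗ[K] E σ ζ p j) (x : E σ ζ p j) :
    ext hσ hζ hp hB hBn hj hj' hjj hne A (x : W) = (A x : W) :=
  extLin_apply_of_mem hσ hζ hp hB hBn hj hj' hjj hne A x

omit [FiniteDimensional K W] in
/-- `σ` acts by `ζ^m` on `E_m`. [folklore] -/
theorem apply_of_mem_E (hσ₀ : σ ^ p = 1) (hζ₀ : IsPrimitiveRoot ζ p) (hp₀ : 0 < p) {m : ℕ} {x : W}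
    (hx : x ∈ E σ ζ p m) : σ x = (ζ ^ m) • x := by
  have hx' : x ∈ Module.End.eigenspace σ (ζ ^ m) := (range_specProj hσ₀ hζ₀ hp₀ m).le hx
  exact Module.End.mem_eigenspace_iff.mp hx'

omit [FiniteDimensional K W] in
/-- Vectors of `E_k`, `E_l` are `B`-orthogonal unless `p ∣ k + l`. [folklore] -/
theorem apply_eq_zero_of_mem_E (hσ₀ : σ ^ p = 1) (hζ₀ : IsPrimitiveRoot ζ p) (hp₀ : 0 < p)
    (hB₀ : ∀ x y, B (σ x) (σ y) = B x y) {k l : ℕ} (hkl : ¬ p ∣ k + l) {x y : W} (hx : x ∈ E σ ζ p k)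
    (hy : y ∈ E σ ζ p l) : B x y = 0 := by
  obtain ⟨x', rfl⟩ := hx
  obtain ⟨y', rfl⟩ := hy
  exact apply_specProj_specProj_eq_zero hσ₀ hζ₀ hp₀ hB₀ hkl x' y'

/-- `extLin A` maps `E_m` into `E_m`. [folklore] -/
theorem extLin_mem (hne : j ≠ p - j) (A : E σ ζ p j ≃ₗ[K] E σ ζ p j) {m : ℕ} (hm : m < p) {x : W}
    (hx : x ∈ E σ ζ p m) : extLin hσ hζ hp hB hBn hj hj' hjj A x ∈ E σ ζ p m := by
  by_cases hmj : m = j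
  · subst hmj; rw [extLin_apply_of_mem hσ hζ hp hB hBn hj hj' hjj hne A ⟨x, hx⟩]; exact (A ⟨x, hx⟩).2
  · by_cases hmj' : m = p - j
    · subst hmj'; rw [extLin_apply_of_mem' hσ hζ hp hB hBn hj hj' hjj hne A ⟨x, hx⟩]
      exact (contra hσ hζ hp hB hBn hj hj' hjj A ⟨x, hx⟩).2
    · rw [extLin_apply_of_mem_other hσ hζ hp hB hBn hj hj' hjj A hm hmj hmj' ⟨x, hx⟩]; exact hx

/-- **`ext A ∈ U⁰(K)`** (for `B` symmetric, `0 < j`, `0 < p - j`). [folklore] -/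
theorem ext_mem_centIso (hne : j ≠ p - j) (hj0 : 0 < j) (hj0' : 0 < p - j) (hBs : ∀ x y, B x y = B y x)
    (A : E σ ζ p j ≃ₗ[K] E σ ζ p j) : ext hσ hζ hp hB hBn hj hj' hjj hne A ∈ centIso σ B := by
  refine ⟨fun w => ?_, fun w w' => ?_, fun x hx => ?_⟩
  · -- commutes with `σ`: check on each eigenblock
    change extLin hσ hζ hp hB hBn hj hj' hjj A (σ w) = σ (extLin hσ hζ hp hB hBn hj hj' hjj A w)
    rw [← LinearMap.comp_apply, ← LinearMap.comp_apply (f := σ)]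
    congr 1
    refine linearMap_ext_of_eigenblocks (σ := σ) hζ hp fun m hm x hx => ?_
    rw [LinearMap.comp_apply, LinearMap.comp_apply, apply_of_mem_E hσ hζ hp hx, map_smul,
      apply_of_mem_E hσ hζ hp (extLin_mem hσ hζ hp hB hBn hj hj' hjj hne A hm hx)]
  · -- isometry: expand both vectors along the eigenblocks
    change B (extLin hσ hζ hp hB hBn hj hj' hjj A w) (extLin hσ hζ hp hB hBn hj hj' hjj A w') = B w w'
    set f := extLin hσ hζ hp hB hBn hj hj' hjj A with hf
    suffices hff : B.compl₁₂ f f = B by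
      have := congrArg (fun C : LinearMap.BilinForm K W => C w w') hff
      simpa only [LinearMap.compl₁₂_apply] using this
    refine LinearMap.ext fun x => ?_
    -- reduce in the first variable
    suffices h1 : ∀ m, m < p → ∀ x ∈ E σ ζ p m, (B.compl₁₂ f f) x = B x by
      rw [← sum_specProj_apply (σ := σ) hζ hp x, map_sum, map_sum]
      exact Finset.sum_congr rfl fun m hm => h1 m (Finset.mem_range.mp hm) _ ⟨x, rfl⟩
    intro m hm x hx
    refine linearMap_ext_of_eigenblocks (σ := σ) hζ hp fun m' hm' y hy => ?_
    rw [LinearMap.compl₁₂_apply]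
    have hfx := extLin_mem hσ hζ hp hB hBn hj hj' hjj hne A hm hx
    have hfy := extLin_mem hσ hζ hp hB hBn hj hj' hjj hne A hm' hy
    by_cases hdvd : p ∣ m + m'
    · -- the paired cases
      by_cases hmj : m = j
      · subst hmj
        have hm'eq : m' = p - m := by
          obtain ⟨c, hc⟩ := hdvd
          rcases Nat.eq_zero_or_pos c with rfl | hcpos
          · omega
          · have : p * c < p * 2 := by rw [← hc]; omega
            have : c < 2 := Nat.lt_of_mul_lt_mul_left this
            have : c = 1 := by omega
            subst this; omega
        subst hm'eq
        rw [extLin_apply_of_mem hσ hζ hp hB hBn hj hj' hjj hne A ⟨x, hx⟩,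
          extLin_apply_of_mem' hσ hζ hp hB hBn hj hj' hjj hne A ⟨y, hy⟩, apply_contra, LinearEquiv.symm_apply_apply]
      · by_cases hmj' : m = p - j
        · subst hmj'
          have hm'eq : m' = j := by
            obtain ⟨c, hc⟩ := hdvd
            rcases Nat.eq_zero_or_pos c with rfl | hcpos
            · omega
            · have : p * c < p * 2 := by rw [← hc]; omega
              have : c < 2 := Nat.lt_of_mul_lt_mul_left this
              have : c = 1 := by omega
              subst this; omega
          subst hm'eq
          rw [extLin_apply_of_mem' hσ hζ hp hB hBn hj hj' hjj hne A ⟨x, hx⟩,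
            extLin_apply_of_mem hσ hζ hp hB hBn hj hj' hjj hne A ⟨y, hy⟩, hBs, apply_contra,
            LinearEquiv.symm_apply_apply, hBs]
        · -- `m ∉ {j, p-j}`: then also `m' ∉ {j, p-j}` and both maps are the identity there
          have hm'j : m' ≠ p - j := by
            intro h; subst h; apply hmj
            obtain ⟨c, hc⟩ := hdvd
            rcases Nat.eq_zero_or_pos c with rfl | hcpos
            · omega
            · have : p * c < p * 2 := by rw [← hc]; omega
              have : c < 2 := Nat.lt_of_mul_lt_mul_left this
              have : c = 1 := by omega
              subst this; omega
          have hm'j' : m' ≠ j := by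
            intro h; subst h; apply hmj'
            obtain ⟨c, hc⟩ := hdvd
            rcases Nat.eq_zero_or_pos c with rfl | hcpos
            · omega
            · have : p * c < p * 2 := by rw [← hc]; omega
              have : c < 2 := Nat.lt_of_mul_lt_mul_left this
              have : c = 1 := by omega
              subst this; omega
          rw [extLin_apply_of_mem_other hσ hζ hp hB hBn hj hj' hjj A hm hmj hmj' ⟨x, hx⟩,
            extLin_apply_of_mem_other hσ hζ hp hB hBn hj hj' hjj A hm' hm'j' hm'j ⟨y, hy⟩]
    · rw [apply_eq_zero_of_mem_E hσ hζ hp hB hdvd hfx hfy, apply_eq_zero_of_mem_E hσ hζ hp hB hdvd hx hy]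
  · -- fixes the `σ`-fixed vectors (`E_0`)
    change extLin hσ hζ hp hB hBn hj hj' hjj A x = x
    have hx0 : x ∈ E σ ζ p 0 := by
      have h : x ∈ Module.End.eigenspace σ (ζ ^ 0) := by
        rw [Module.End.mem_eigenspace_iff, pow_zero, one_smul]; exact hx
      exact (range_specProj hσ hζ hp 0).ge h
    exact extLin_apply_of_mem_other hσ hζ hp hB hBn hj hj' hjj A hp (by omega) (by omega) ⟨x, hx0⟩

end Ext

/-! ### §3 The uniqueness principle in `U⁰(K)` -/

omit [FiniteDimensional K W] in
/-- Two elements of `U⁰(K)` that agree on `E_j` agree on `E_{p-j}` (`j < p`). [folklore] -/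
theorem centIso_eq_on_opposite (hσ : σ ^ p = 1) (hζ : IsPrimitiveRoot ζ p) (hp : 0 < p)
    (hB : ∀ x y, B (σ x) (σ y) = B x y) (hBn : B.Nondegenerate) {j : ℕ} (hj : j < p)
    {γ γ' : W ≃ₗ[K] W} (hγ : γ ∈ centIso σ B) (hγ' : γ' ∈ centIso σ B)
    (heq : ∀ x ∈ E σ ζ p j, γ x = γ' x) {y : W} (hy : y ∈ E σ ζ p (p - j)) : γ y = γ' y :=
  centraliser_ext_of_eq_on hσ hζ hp hB hBn hj (by rw [Nat.add_sub_cancel' hj.le]) hγ.1 hγ'.1 hγ.2.1 hγ'.2.1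
    heq hy


end Summit.HodgeConjecture.HodgeConjecture.Theorems.CyclicUnitaryPowersBlockExtension

end
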